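import Summits.CriticalPhenomena.PercolationContinuityZ3.Theorems.SahiCISAtomic

/-!
# CIS for finitely-atomic laws on the cube: a kernel-decidable form of the atom condition

Cell `prim-sahi`, literature seat (generation 31; Theorems/ being prover-only, to be landed by a prover seat);
`--supports stmt-CriticalPhenomena-4575`.  No named facts, no sorries.  Companion of `SahiCISAtomic.lean`
(typer gen 17: on finitely supported laws the a.e.-kernel notion `IsCISae` IS the classical atom condition
`IsCISatom`).

For a law `∑ₖ wₖ • δ_{e ∘ cₖ}` on `Q_d = [0,1]^d` whose atoms have coordinates in a finite chain
`e : Fin m → [0,1]` (strictly increasing; `cₖ : Fin d → Fin m` the codes, `wₖ ∈ ℕ` the weights), the atom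
condition at every level is equivalent to finitely many inequalities between natural numbers — conditioning
prefixes range over the prefixes of atoms, thresholds over the code values — packaged as a `Bool`
(`cisCheckAll`) that the kernel evaluates by `decide`:

* `atomicLaw p w = ∑ₖ wₖ • δ_{pₖ}`; evaluation (`atomicLaw_apply_of_iff`), push-forward (`atomicLaw_map`),
  finite support, total mass; scaling invariance of the atom condition (`isCISatom_smul_iff`).
* `codedLaw e c w`; the conditioning marginal of a coded law is the coded law of the prefixes
  (`fst_map_initLast_codedLaw`); relabelling coordinates (`codedLaw_map_comp`).
* **`condIncrAtom_codedLaw_iff`**, **`isCISatom_codedLaw_iff`**: `IsCISatom d (codedLaw e c w) ↔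
  cisCheckAll d c w = true`; with `SahiCISAtomic`: **`isCISae_smul_codedLaw_iff`** for the normalised law.

Used in `SahiCISMonotoneImageCI.lean` (a CI law whose image under a coordinatewise increasing map is not CIS).
References for the notions: Müller–Stoyan 2002, Def. 3.10.9 [MullerStoyan2002].  Statements are this work.
-/

noncomputable section

namespace Summit.CriticalPhenomena.PercolationContinuityZ3.Theorems.SahiCIS

open MeasureTheory Set Function
open Summit.CriticalPhenomena.PercolationContinuityZ3.Theorems.SahiBoxTP2
open scoped ENNReal unitInterval

/-! ### Finitely-atomic laws with natural weights -/

section AtomicLaw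

variable {α β : Type*} [MeasurableSpace α] [MeasurableSpace β] {n : ℕ}

/-- Push-forward of a finite sum of measures. [folklore] -/
theorem map_finsetSum {ι : Type*} (s : Finset ι) (μ : ι → Measure α) {f : α → β} (hf : Measurable f) :
    (∑ i ∈ s, μ i).map f = ∑ i ∈ s, (μ i).map f := by
  classical
  induction s using Finset.induction_on with
  | empty => simp
  | insert a s ha ih => rw [Finset.sum_insert ha, Finset.sum_insert ha, Measure.map_add _ _ hf, ih]

/-- **The finitely-atomic law** `∑ₖ w k • δ_{p k}` (natural weights). [this work] -/
def atomicLaw (p : Fin n → α) (w : Fin n → ℕ) : Measure α := ∑ k, (w k : ℝ≥0∞) • Measure.dirac (p k)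

/-- Evaluation on a measurable set: `∑ₖ w k · 1_s(p k)`. [this work] -/
theorem atomicLaw_apply (p : Fin n → α) (w : Fin n → ℕ) {s : Set α} (hs : MeasurableSet s) :
    atomicLaw p w s = ∑ k, (w k : ℝ≥0∞) * s.indicator 1 (p k) := by
  rw [atomicLaw, Measure.finsetSum_apply]
  exact Finset.sum_congr rfl fun k _ => by rw [Measure.smul_apply, smul_eq_mul, Measure.dirac_apply' _ hs]

/-- Evaluation on a measurable set as a natural number, given a decidable description of the atoms it contains.
[this work] -/
theorem atomicLaw_apply_of_iff (p : Fin n → α) (w : Fin n → ℕ) {s : Set α} (hs : MeasurableSet s)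
    (P : Fin n → Prop) [DecidablePred P] (hP : ∀ k, p k ∈ s ↔ P k) :
    atomicLaw p w s = ((∑ k, if P k then w k else 0 : ℕ) : ℝ≥0∞) := by
  rw [atomicLaw_apply p w hs, Nat.cast_sum]
  refine Finset.sum_congr rfl fun k _ => ?_
  by_cases hk : P k
  · rw [indicator_of_mem ((hP k).2 hk), Pi.one_apply, mul_one, if_pos hk]
  · rw [indicator_of_notMem (fun h => hk ((hP k).1 h)), mul_zero, if_neg hk, Nat.cast_zero]

/-- A measurable set containing no atom is null. [this work] -/
theorem atomicLaw_apply_eq_zero (p : Fin n → α) (w : Fin n → ℕ) {s : Set α} (hs : MeasurableSet s)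
    (h : ∀ k, p k ∉ s) : atomicLaw p w s = 0 := by
  rw [atomicLaw_apply_of_iff p w hs (fun _ => False) (fun k => iff_of_false (h k) id)]
  simp

/-- The total mass is `∑ₖ w k`. [this work] -/
theorem atomicLaw_univ (p : Fin n → α) (w : Fin n → ℕ) :
    atomicLaw p w univ = ((∑ k, w k : ℕ) : ℝ≥0∞) := by
  rw [atomicLaw_apply_of_iff p w MeasurableSet.univ (fun _ => True) (fun k => iff_of_true (mem_univ _) trivial)]
  simp

/-- A finitely-atomic law with natural weights is a finite measure. [folklore] -/
instance isFiniteMeasure_atomicLaw (p : Fin n → α) (w : Fin n → ℕ) : IsFiniteMeasure (atomicLaw p w) :=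
  ⟨by rw [atomicLaw_univ]; exact ENNReal.natCast_lt_top _⟩

/-- A finitely-atomic law has finite support. [folklore] -/
theorem exists_finset_support_atomicLaw [MeasurableSingletonClass α] (p : Fin n → α) (w : Fin n → ℕ) :
    ∃ D : Finset α, atomicLaw p w (↑D)ᶜ = 0 := by
  classical
  refine ⟨Finset.univ.image p, atomicLaw_apply_eq_zero p w (Finset.measurableSet _).compl fun k hk => ?_⟩
  exact hk (Finset.mem_coe.2 (Finset.mem_image_of_mem p (Finset.mem_univ k)))

/-- **Push-forward of an atomic law**: move the atoms. [this work] -/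
theorem atomicLaw_map (p : Fin n → α) (w : Fin n → ℕ) {f : α → β} (hf : Measurable f) :
    (atomicLaw p w).map f = atomicLaw (f ∘ p) w := by
  rw [atomicLaw, map_finsetSum _ _ hf]
  exact Finset.sum_congr rfl fun k _ => by rw [Measure.map_smul, Measure.map_dirac' hf]; rfl

end AtomicLaw

/-! ### Scaling invariance of the atom condition -/

section Smul

variable {d : ℕ}

/-- `(r • ρ).fst = r • ρ.fst`. [folklore] -/
theorem fst_smul_measure {γ δ : Type*} [MeasurableSpace γ] [MeasurableSpace δ] (r : ℝ≥0∞)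
    (ρ : Measure (γ × δ)) :
    (r • ρ).fst = r • ρ.fst :=
  Measure.map_smul r ρ Prod.fst

/-- The atom condition is invariant under scaling by `r ∈ (0, ∞)`. [this work] -/
theorem condIncrAtom_smul_iff (μ : Measure (Fin (d + 1) → I)) {r : ℝ≥0∞} (h0 : r ≠ 0) (hT : r ≠ ⊤) :
    CondIncrAtom (r • μ) ↔ CondIncrAtom μ := by
  have key : ∀ A B C D : ℝ≥0∞, r * A * (r * B) ≤ r * C * (r * D) ↔ A * B ≤ C * D := fun A B C D => by
    rw [show r * A * (r * B) = r * r * (A * B) by ring, show r * C * (r * D) = r * r * (C * D) by ring]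
    exact ENNReal.mul_le_mul_iff_right (mul_ne_zero h0 h0) (ENNReal.mul_ne_top hT hT)
  simp only [CondIncrAtom, Measure.map_smul, fst_smul_measure, Measure.smul_apply, smul_eq_mul, key]

/-- `IsCISatom` is invariant under scaling by `r ∈ (0, ∞)`. [this work] -/
theorem isCISatom_smul_iff {r : ℝ≥0∞} (h0 : r ≠ 0) (hT : r ≠ ⊤) :
    ∀ (d : ℕ) (μ : Measure (Fin d → I)), IsCISatom d (r • μ) ↔ IsCISatom d μ
  | 0, _ => Iff.rfl
  | d + 1, μ => by
    rw [IsCISatom, IsCISatom, Measure.map_smul, fst_smul_measure, isCISatom_smul_iff h0 hT d,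
      condIncrAtom_smul_iff μ h0 hT]

end Smul

/-! ### Coded atomic laws on the cube -/

section Coded

variable {n m d : ℕ}

/-- The first component of `initLast` is `Fin.init`. [folklore] -/
theorem initLast_fst_eq_init (y : Fin (d + 1) → I) : (initLast y).1 = Fin.init y := Fin.removeNth_last y

/-- The second component of `initLast` is the last coordinate. [folklore] -/
theorem initLast_snd_eq (y : Fin (d + 1) → I) : (initLast y).2 = y (Fin.last d) := rfl

/-- **The coded atomic law** `∑ₖ w k • δ_{e ∘ c k}` on `Q_d`: atom `k` sits at
`(e (c k 0), …, e (c k (d-1)))` for a chain of values `e : Fin m → [0,1]`. [this work] -/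
def codedLaw (e : Fin m → I) (c : Fin n → Fin d → Fin m) (w : Fin n → ℕ) : Measure (Fin d → I) :=
  atomicLaw (fun k => e ∘ c k) w

/-- Total mass of a coded law. [this work] -/
theorem codedLaw_univ (e : Fin m → I) (c : Fin n → Fin d → Fin m) (w : Fin n → ℕ) :
    codedLaw e c w univ = ((∑ k, w k : ℕ) : ℝ≥0∞) :=
  atomicLaw_univ _ w

/-- A coded law is a finite measure. [folklore] -/
instance isFiniteMeasure_codedLaw (e : Fin m → I) (c : Fin n → Fin d → Fin m) (w : Fin n → ℕ) :
    IsFiniteMeasure (codedLaw e c w) :=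
  isFiniteMeasure_atomicLaw _ w

/-- A coded law has finite support. [folklore] -/
theorem exists_finset_support_codedLaw (e : Fin m → I) (c : Fin n → Fin d → Fin m) (w : Fin n → ℕ) :
    ∃ D : Finset (Fin d → I), codedLaw e c w (↑D)ᶜ = 0 :=
  exists_finset_support_atomicLaw _ w

/-- **Relabelling coordinates**: the law of `(x_{τ 0}, …, x_{τ (d'-1)})` under a coded law is the coded law of the
relabelled codes (any map `τ`, injective or not). [this work] -/
theorem codedLaw_map_comp {d' : ℕ} (e : Fin m → I) (c : Fin n → Fin d → Fin m) (w : Fin n → ℕ)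
    (τ : Fin d' → Fin d) :
    (codedLaw e c w).map (fun x : Fin d → I => x ∘ τ) = codedLaw e (fun k => c k ∘ τ) w := by
  have hτ : Measurable fun x : Fin d → I => x ∘ τ := measurable_pi_lambda _ fun i => measurable_pi_apply (τ i)
  rw [codedLaw, atomicLaw_map _ w hτ]
  rfl

/-- **The conditioning marginal of a coded law is the coded law of the prefixes.** [this work] -/
theorem fst_map_initLast_codedLaw (e : Fin m → I) (c : Fin n → Fin (d + 1) → Fin m) (w : Fin n → ℕ) :
    ((codedLaw e c w).map initLast).fst = codedLaw e (fun k => Fin.init (c k)) w := by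
  rw [Measure.fst, codedLaw, atomicLaw_map _ w measurable_initLast, atomicLaw_map _ w measurable_fst, codedLaw]
  congr 1
  funext k
  show (initLast (e ∘ c k)).1 = e ∘ Fin.init (c k)
  rw [initLast_fst_eq_init]
  rfl

/-- Mass of the atoms with prefix `u`. [this work] -/
def cisMassAt (c : Fin n → Fin (d + 1) → Fin m) (w : Fin n → ℕ) (u : Fin d → Fin m) : ℕ :=
  ∑ k, if (∀ l : Fin d, c k (Fin.castSucc l) = u l) then w k else 0

/-- Mass of the atoms with prefix `u` and last code `≤ t`. [this work] -/
def cisMassLE (c : Fin n → Fin (d + 1) → Fin m) (w : Fin n → ℕ) (u : Fin d → Fin m) (t : Fin m) : ℕ :=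
  ∑ k, if ((∀ l : Fin d, c k (Fin.castSucc l) = u l) ∧ c k (Fin.last d) ≤ t) then w k else 0

/-- **The atom condition for the last coordinate, as a `Bool`**: for all atoms `i, j` with prefixes
`u_i ≤ u_j` and all code thresholds `t`, `M(u_j, ≤ t) · m(u_i) ≤ M(u_i, ≤ t) · m(u_j)`. [this work] -/
def cisCheckLevel (c : Fin n → Fin (d + 1) → Fin m) (w : Fin n → ℕ) : Bool :=
  decide (∀ i j : Fin n, (∀ l : Fin d, c i (Fin.castSucc l) ≤ c j (Fin.castSucc l)) → ∀ t : Fin m,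
    cisMassLE c w (fun l => c j (Fin.castSucc l)) t * cisMassAt c w (fun l => c i (Fin.castSucc l)) ≤
      cisMassLE c w (fun l => c i (Fin.castSucc l)) t * cisMassAt c w (fun l => c j (Fin.castSucc l)))

/-- **The atom condition at every level, as a `Bool`.** [this work] -/
def cisCheckAll : (d : ℕ) → (Fin n → Fin d → Fin m) → (Fin n → ℕ) → Bool
  | 0, _, _ => true
  | d + 1, c, w => cisCheckAll d (fun k => Fin.init (c k)) w && cisCheckLevel c w

variable {e : Fin m → I}

/-- The conditioning marginal at a coded prefix `e ∘ u`: the mass of the atoms with prefix `u`. [this work] -/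
theorem codedLaw_init_singleton (he : StrictMono e) (c : Fin n → Fin (d + 1) → Fin m) (w : Fin n → ℕ)
    (u : Fin d → Fin m) :
    codedLaw e (fun k => Fin.init (c k)) w {e ∘ u} = (cisMassAt c w u : ℝ≥0∞) := by
  unfold cisMassAt
  refine atomicLaw_apply_of_iff _ w (measurableSet_singleton _) _ fun k => ?_
  rw [mem_singleton_iff, he.injective.comp_left.eq_iff, funext_iff]
  rfl

/-- The conditioning marginal vanishes at points that are not coded prefixes of atoms. [this work] -/
theorem codedLaw_init_singleton_eq_zero (c : Fin n → Fin (d + 1) → Fin m) (w : Fin n → ℕ)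
    {a : Fin d → I} (ha : ∀ k, e ∘ Fin.init (c k) ≠ a) :
    codedLaw e (fun k => Fin.init (c k)) w {a} = 0 :=
  atomicLaw_apply_eq_zero _ w (measurableSet_singleton _) fun k hk => ha k (mem_singleton_iff.1 hk)

/-- The joint law on `{e ∘ u} × [0, x]` when `x` cuts the code chain at `t` (`e v ≤ x ↔ v ≤ t`): the mass
of the atoms with prefix `u` and last code `≤ t`. [this work] -/
theorem map_initLast_codedLaw_prod_Iic (he : StrictMono e) (c : Fin n → Fin (d + 1) → Fin m) (w : Fin n → ℕ)
    (u : Fin d → Fin m) {x : I} {t : Fin m} (hx : ∀ v, e v ≤ x ↔ v ≤ t) :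
    (codedLaw e c w).map initLast ({e ∘ u} ×ˢ Iic x) = (cisMassLE c w u t : ℝ≥0∞) := by
  unfold cisMassLE
  rw [codedLaw, atomicLaw_map _ w measurable_initLast]
  refine atomicLaw_apply_of_iff _ w ((measurableSet_singleton _).prod measurableSet_Iic) _ fun k => ?_
  rw [comp_apply, mem_prod, mem_singleton_iff, mem_Iic, initLast_fst_eq_init, initLast_snd_eq,
    show Fin.init (e ∘ c k) = e ∘ Fin.init (c k) from rfl, he.injective.comp_left.eq_iff, funext_iff,
    comp_apply, hx]
  rfl

/-- The joint law does not charge `{a} × B` when `a` is not a coded prefix of an atom. [this work] -/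
theorem map_initLast_codedLaw_prod_eq_zero (c : Fin n → Fin (d + 1) → Fin m) (w : Fin n → ℕ)
    {a : Fin d → I} (ha : ∀ k, e ∘ Fin.init (c k) ≠ a) {B : Set I} (hB : MeasurableSet B) :
    (codedLaw e c w).map initLast ({a} ×ˢ B) = 0 := by
  rw [codedLaw, atomicLaw_map _ w measurable_initLast]
  refine atomicLaw_apply_eq_zero _ w ((measurableSet_singleton _).prod hB) fun k hk => ha k ?_
  have h1 := (mem_prod.1 hk).1
  rw [mem_singleton_iff, comp_apply, initLast_fst_eq_init] at h1
  exact h1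

/-- The joint law does not charge `{a} × [0, x]` when `x` lies below every code value. [this work] -/
theorem map_initLast_codedLaw_prod_Iic_eq_zero (c : Fin n → Fin (d + 1) → Fin m) (w : Fin n → ℕ)
    (a : Fin d → I) {x : I} (hx : ∀ v, ¬ e v ≤ x) :
    (codedLaw e c w).map initLast ({a} ×ˢ Iic x) = 0 := by
  rw [codedLaw, atomicLaw_map _ w measurable_initLast]
  refine atomicLaw_apply_eq_zero _ w ((measurableSet_singleton _).prod measurableSet_Iic) fun k hk => ?_
  have h2 := (mem_prod.1 hk).2
  rw [mem_Iic, comp_apply, initLast_snd_eq] at h2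
  exact hx _ h2

/-- Every `x ∈ [0,1]` above some code value cuts the code chain at a code `t`: `e v ≤ x ↔ v ≤ t`. [folklore] -/
theorem exists_cut_of_exists_le (he : StrictMono e) {x : I} (hx : ∃ v, e v ≤ x) :
    ∃ t : Fin m, ∀ v, e v ≤ x ↔ v ≤ t := by
  classical
  obtain ⟨v₀, hv₀⟩ := hx
  obtain ⟨t, ht, hmax⟩ := Finset.exists_max_image (Finset.univ.filter fun v => e v ≤ x) id
    ⟨v₀, Finset.mem_filter.2 ⟨Finset.mem_univ _, hv₀⟩⟩
  refine ⟨t, fun v => ⟨fun hv => hmax v (Finset.mem_filter.2 ⟨Finset.mem_univ _, hv⟩), fun hv => ?_⟩⟩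
  exact (he.monotone hv).trans (Finset.mem_filter.1 ht).2

/-- **The atom condition for a coded law is the `Bool` check.** [this work] -/
theorem condIncrAtom_codedLaw_iff (he : StrictMono e) (c : Fin n → Fin (d + 1) → Fin m) (w : Fin n → ℕ) :
    CondIncrAtom (codedLaw e c w) ↔ cisCheckLevel c w = true := by
  constructor
  · intro h
    refine decide_eq_true fun i j hij t => ?_
    have hab : (e ∘ fun l => c i (Fin.castSucc l)) ≤ (e ∘ fun l => c j (Fin.castSucc l)) :=
      fun l => he.monotone (hij l)
    have key := h hab (e t)
    rw [fst_map_initLast_codedLaw, codedLaw_init_singleton he, codedLaw_init_singleton he,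
      map_initLast_codedLaw_prod_Iic he c w _ (fun v => he.le_iff_le),
      map_initLast_codedLaw_prod_Iic he c w _ (fun v => he.le_iff_le)] at key
    exact_mod_cast key
  · intro h a b hab x
    have H := of_decide_eq_true h
    by_cases ha : ∃ i, e ∘ Fin.init (c i) = a
    swap
    · rw [fst_map_initLast_codedLaw, codedLaw_init_singleton_eq_zero c w (fun k hk => ha ⟨k, hk⟩), mul_zero]
      exact bot_le
    obtain ⟨i, rfl⟩ := ha
    by_cases hb : ∃ j, e ∘ Fin.init (c j) = b
    swap
    · rw [map_initLast_codedLaw_prod_eq_zero c w (fun k hk => hb ⟨k, hk⟩) measurableSet_Iic, zero_mul]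
      exact bot_le
    obtain ⟨j, rfl⟩ := hb
    by_cases hx : ∃ v, e v ≤ x
    swap
    · rw [map_initLast_codedLaw_prod_Iic_eq_zero c w _ (fun v hv => hx ⟨v, hv⟩), zero_mul]
      exact bot_le
    obtain ⟨t, ht⟩ := exists_cut_of_exists_le he hx
    have hij : ∀ l : Fin d, c i (Fin.castSucc l) ≤ c j (Fin.castSucc l) := fun l => he.le_iff_le.1 (hab l)
    have key := H i j hij t
    rw [fst_map_initLast_codedLaw, show Fin.init (c i) = fun l => c i (Fin.castSucc l) from rfl,
      show Fin.init (c j) = fun l => c j (Fin.castSucc l) from rfl, codedLaw_init_singleton he,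
      codedLaw_init_singleton he, map_initLast_codedLaw_prod_Iic he c w _ ht,
      map_initLast_codedLaw_prod_Iic he c w _ ht]
    exact_mod_cast key

/-- **`IsCISatom` for a coded law is the `Bool` check at every level.** [this work] -/
theorem isCISatom_codedLaw_iff (he : StrictMono e) :
    ∀ (d : ℕ) (c : Fin n → Fin d → Fin m) (w : Fin n → ℕ),
      IsCISatom d (codedLaw e c w) ↔ cisCheckAll d c w = true
  | 0, _, _ => by simp [IsCISatom, cisCheckAll]
  | d + 1, c, w => by
    rw [IsCISatom, cisCheckAll, Bool.and_eq_true, fst_map_initLast_codedLaw, isCISatom_codedLaw_iff he d,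
      condIncrAtom_codedLaw_iff he]

/-- **CIS in the a.e.-kernel sense for a normalised coded law is the `Bool` check at every level**
(`SahiCISAtomic.isCISae_iff_isCISatom_of_finite_support`). [this work] -/
theorem isCISae_smul_codedLaw_iff (he : StrictMono e) (c : Fin n → Fin d → Fin m) (w : Fin n → ℕ)
    {r : ℝ≥0∞} (h0 : r ≠ 0) (hT : r ≠ ⊤) [IsProbabilityMeasure (r • codedLaw e c w)] :
    IsCISae d (r • codedLaw e c w) ↔ cisCheckAll d c w = true := by
  obtain ⟨D, hD⟩ := exists_finset_support_codedLaw e c w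
  have hD' : (r • codedLaw e c w) (↑D)ᶜ = 0 := by rw [Measure.smul_apply, smul_eq_mul, hD, mul_zero]
  rw [isCISae_iff_isCISatom_of_finite_support _ ⟨D, hD'⟩, isCISatom_smul_iff h0 hT, isCISatom_codedLaw_iff he]

end Coded

end Summit.CriticalPhenomena.PercolationContinuityZ3.Theorems.SahiCIS

end
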